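import Mathlib
import HarnessLib
import Summits.HubbardSuperconductivity.HubbardSuperconductivity.Theorems.KLProgrammePolarRayCoarea

/-!
# Route `KLProgramme` — ENGINE stmt-HubbardSuperconductivity-20437 `KLRegimeEngineV17F2`, row (c) value lane: the planar bound from an ANGLE-DEPENDENT ray bound
# (brick 1 of cure (A″) of located «(c)-OUT-COOPER-ANTIPODE»; cell gate-hubbard-kl, seat hubbard-kl-k3c2-p2 g25)

WHY.  `klry_norm_smul_sum_integral_le_of_ray_bound` (…PolarRayCoarea, g2) turns a UNIFORM ray bound `B` of the per-ray zero-sound / thermal / transfer estimates into the planar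
bound `2π·B`.  The kernel data of the dressed vertex are NOT uniform in the loop angle: near the Cooper antipode of an external leg the radial-Lipschitz modulus and the
frequency flatness blow up like `1/|θ − θ*|` resp. `Λ/|θ − θ*|` down to `|θ − θ*| ~ Λ`, but stay INTEGRABLE in `θ` (memo COOPER-ANTIPODE.md, evidence on 20437).  This file
supplies the θ-dependent twin: a ray bound `B(θ)` gives the planar bound `∫_{(−π,π)} B(θ) dθ` — and its two practical forms, an a.e./integrable version and a CELL version
(piecewise data on a finite family of angular cells covering `(−π, π)`, bound `Σ_c |cell_c|·B_c`).
* **`klry_norm_smul_sum_integral_le_of_ray_bound_fn`** — `‖c • Σᵢ ∫ hᵢ‖ ≤ ∫ θ in Ioo (−π) π, B θ` for an integrable angle profile `B` dominating the ray expression;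
* **`klry_norm_smul_sum_integral_le_of_ray_bound_mono`** — the same from a pointwise bound `B ≤ B'` with `B'` integrable (e.g. `B' = min(sup, C/|θ−θ*|)` envelopes);
* **`klry_norm_smul_sum_integral_le_of_ray_bound_indicator_sum`** — CELL form: `B θ ≤ Σ_c B_c·𝟙_{S_c}(θ)` with measurable cells `S_c` ⇒ `‖…‖ ≤ Σ_c B_c·|S_c ∩ (−π,π)|`.
Pure measure theory over the landed coarea identity; nothing about the model is asserted.  0 kit · 0 lit.
-/

noncomputable section

namespace Summit.HubbardSuperconductivity.HubbardSuperconductivity.Theorems.KLRegimeSplit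

set_option linter.dupNamespace false -- summit = problem name (single-conjunct summit), D-0017

open Real Set MeasureTheory intervalIntegral Literature.Analysis.Calculus

variable {E : Type*} [NormedAddCommGroup E] [NormedSpace ℝ E]

/-- **Planar bound from an ANGLE-DEPENDENT ray bound**: if along every ray `θ ∈ (−π, π)` the (weighted, summed) ray integral is bounded by `B θ` with `B` integrable on
`(−π, π)`, then `‖c • Σᵢ ∫ hᵢ‖ ≤ ∫_{θ ∈ (−π,π)} B θ dθ`. -/
theorem klry_norm_smul_sum_integral_le_of_ray_bound_fn {ι : Type*} [Fintype ι] {h : ι → ℝ × ℝ → E} (hint : ∀ i, Integrable (h i))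
    {c : ℝ} {B : ℝ → ℝ} (hBi : IntegrableOn B (Ioo (-π) π))
    (hB : ∀ θ ∈ Ioo (-π) π, ‖c • ∑ i, ∫ t in Ioi (0 : ℝ), t • h i (t * Real.cos θ, t * Real.sin θ)‖ ≤ B θ) :
    ‖c • ∑ i, ∫ p, h i p‖ ≤ ∫ θ in Ioo (-π) π, B θ := by
  -- move everything under one angular integral (as in the uniform lemma)
  have h1 : (c • ∑ i, ∫ p, h i p) =
      ∫ θ in Ioo (-π) π, c • ∑ i, ∫ t in Ioi (0 : ℝ), t • h i (t * Real.cos θ, t * Real.sin θ) := by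
    rw [MeasureTheory.integral_smul, integral_finsetSum _ (fun i _ => klry_integrableOn_ray_integral (hint i))]
    congr 1
    refine Finset.sum_congr rfl fun i _ => ?_
    exact klry_integral_eq_integral_Ioo_integral_Ioi_polar (hint i)
  rw [h1]
  refine norm_integral_le_of_norm_le hBi ?_
  exact (ae_restrict_iff' measurableSet_Ioo).mpr (Filter.Eventually.of_forall hB)

/-- The same from a pointwise ray bound `B` dominated on `(−π, π)` by an integrable profile `B'` (no measurability asked of `B`). -/
theorem klry_norm_smul_sum_integral_le_of_ray_bound_mono {ι : Type*} [Fintype ι] {h : ι → ℝ × ℝ → E} (hint : ∀ i, Integrable (h i))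
    {c : ℝ} {B B' : ℝ → ℝ} (hB'i : IntegrableOn B' (Ioo (-π) π)) (hBB' : ∀ θ ∈ Ioo (-π) π, B θ ≤ B' θ)
    (hB : ∀ θ ∈ Ioo (-π) π, ‖c • ∑ i, ∫ t in Ioi (0 : ℝ), t • h i (t * Real.cos θ, t * Real.sin θ)‖ ≤ B θ) :
    ‖c • ∑ i, ∫ p, h i p‖ ≤ ∫ θ in Ioo (-π) π, B' θ :=
  klry_norm_smul_sum_integral_le_of_ray_bound_fn hint hB'i fun θ hθ => (hB θ hθ).trans (hBB' θ hθ)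

/-- **CELL form**: if the ray bound is dominated by finitely many cell constants, `B θ ≤ Σ_c B_c·𝟙_{S_c}(θ)` on `(−π, π)` (cells `S_c` measurable, not
necessarily disjoint), then `‖c • Σᵢ ∫ hᵢ‖ ≤ Σ_c B_c · volume.real (S_c ∩ Ioo (−π) π)` — the Riemann-sum shape in which cell-wise kernel data are booked (a cell of angular
width `w` around the Cooper antipode costs `w·B_c`). -/
theorem klry_norm_smul_sum_integral_le_of_ray_bound_indicator_sum {ι κ : Type*} [Fintype ι] [Fintype κ] {h : ι → ℝ × ℝ → E}
    (hint : ∀ i, Integrable (h i)) {c : ℝ} {Bc : κ → ℝ} {S : κ → Set ℝ} (hS : ∀ k, MeasurableSet (S k))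
    (hB : ∀ θ ∈ Ioo (-π) π, ‖c • ∑ i, ∫ t in Ioi (0 : ℝ), t • h i (t * Real.cos θ, t * Real.sin θ)‖ ≤ ∑ k, Bc k * (S k).indicator 1 θ) :
    ‖c • ∑ i, ∫ p, h i p‖ ≤ ∑ k, Bc k * volume.real (S k ∩ Ioo (-π) π) := by
  have hvol : volume (Ioo (-π) π) < ⊤ := by rw [Real.volume_Ioo]; exact ENNReal.ofReal_lt_top
  have h1i : IntegrableOn (fun _ : ℝ => (1 : ℝ)) (Ioo (-π) π) := integrableOn_const (hs := hvol.ne)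
  have hIk : ∀ k, IntegrableOn (fun θ => Bc k * (S k).indicator (1 : ℝ → ℝ) θ) (Ioo (-π) π) := fun k =>
    Integrable.const_mul (h1i.indicator (hS k)) _
  have hI : IntegrableOn (fun θ => ∑ k, Bc k * (S k).indicator (1 : ℝ → ℝ) θ) (Ioo (-π) π) :=
    integrable_finsetSum _ fun k _ => hIk k
  refine (klry_norm_smul_sum_integral_le_of_ray_bound_fn hint hI hB).trans (le_of_eq ?_)
  rw [integral_finsetSum _ fun k _ => hIk k]
  refine Finset.sum_congr rfl fun k _ => ?_
  rw [MeasureTheory.integral_const_mul, MeasureTheory.integral_indicator (hS k), Measure.restrict_restrict (hS k)]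
  simp only [Pi.one_apply, setIntegral_const, smul_eq_mul, mul_one]

end Summit.HubbardSuperconductivity.HubbardSuperconductivity.Theorems.KLRegimeSplit

end
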